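import Summits.QuantumFields.YangMills.Theorems.BalabanUVNodesN20FinalLevelRatioDomination
import Literature.MathematicalPhysics.QuantumFieldTheory.Balaban1983to89.T4HistoryPeeling
import Literature.MathematicalPhysics.QuantumFieldTheory.Balaban1983to89.T4InsertionProfile

/-!
# N20 (NE7b) WITHOUT A TOWER, II: the SINGLE-SLOT CLAUSE of the pub-balaban cell's `T4HistoryPeeling.SlotDom` — «the terms pending at slot `i` that switch off to the context `τ″` weigh at
# most `x i` times `τ″`» — on def-R's objects, from ONE per-history FIBREWISE letter (print's (1.79)∕(1.89)⁺ KIND on [IV] (0.3)'s fibre ratio) and the fibre count `Σ_{off i τ = τ″} z ≤ x i`;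
# so the cell's peeling liaison `relWeightBound_of_slotDom(_twoRate)` is fed, per `(K, t)`, by per-history letters — no tower, no (T), no pin

Cell `pub-ymgap`, YM-PLAN Track A (HUMAN RULING D-0062); seat `pub-ymgap-dag-n20-d` (R134 (a) N20 NE7b s3), gen 39; companion of `…N20FinalLevelRatioDomination` (gen 39, p768103: fibrewise
domination integrates; bad class ≤ fibre multiplicity × image classes) and of the pub-balaban cell's `T4HistoryPeeling` (`SwitchOff`, `SlotDom`, `relWeightBound_of_slotDom`,
`relWeightBound_of_slotDom_twoRate`) ∕ `T4PersistentHistoryCount` (the COUNTING half of NE7b: `slotDom_of_records`, budgets, survival condition).  `--kind proof --supports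
stmt-QuantumFields-27366 --as helper` (K3⁸); COUNT-NEUTRAL; THEOREMS ONLY (0 `def`).  [IV] = [Balaban1989LargeFieldI]; [LF-II] = [Balaban1989LargeFieldII].

WHY.  `T4HistoryPeeling.SlotDom l₀ T A Bad S` asks, per `(K, t)`, for a switch-off structure `Φ : SwitchOff (T K) n` (pending flags `pend i`, deletion maps `off i`), activities `0 ≤ x i` with
`Σ x ≤ S K`, `Bad K t = Φ.bad`, and the SINGLE-SLOT CLAUSE `∀ i, ∀ τ″ ∈ T K, pend i τ″ = false → Σ_{τ ∈ T K : pend i τ ∧ off i τ = τ″} A K t τ ≤ x i · A K t τ″`; its docstring names the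
clause's context-uniformity «the unprinted heart of NE7b».  On def-R's objects the context-uniform currency IS the fibrewise one: a bound `∫⌈_{Z′}t_τ (V) ≤ z(τ)·∫⌈_{Z′}t_{off i τ}(V)` at EVERY
`V` is uniform in everything outside the deleted component's own bond variables and integrated over those — [LF-II] (1.79) p. 383 «sup … over all admissible domains … for all large field
regions» + p. 387 ll. 25–29, read on [IV] (0.3)'s ratio.  The companion's §2 turns such letters on ONE switch-off fibre into exactly the clause (the image of the fibre under `off i` is
`{τ″}`), with `x i` any bound of the fibre count `Σ_{τ : pend i τ ∧ off i τ = τ″} z τ` uniform in `τ″` — the count is the cell's `T4PersistentHistoryCount` currency (records of ONE component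
inserted into a frozen context).  So, per `(K, t)`: per-history fibrewise letters + fibre counts + a budget `Σ x ≤ S K` give the body of `SlotDom.dom` (§2), and both runs' `SlotDom` give
`RelWeightBound` by the cell's liaison BY NAME — the tower-free road of LOCATED-5 (K3⁸ evidence #58) docked at the pub-balaban cell's NE7b row.

WHAT IS PROVED (kernel; finite sums over the companion's §1–§2).  §1 (generic finite family of non-negative integrable measurable densities `t : ι → Density`, any `T : Finset ι`,
`Φ : SwitchOff T n`, per-slot fibre sets `fib i τ` and factors `z i τ`): ★★ `singleSlotClause_of_fibreDom` (hDom on the pending terms of slot `i` + `Σ_{fibre of τ″} z i ≤ x i`, `0 ≤ x i` ⇒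
the clause for `A τ = ∫ t_τ`), `singleSlotClause_of_ratioLetter` (hDom from the sup form on the ratio + support clause).  §2 ★★ `slotDomBody_of_fibreDom`: with a budget `Σ_i x i ≤ S` the
whole body of `SlotDom.dom` at one `(K, t)` — `∃ n Φ x, (∀ i, 0 ≤ x i) ∧ Σ x ≤ S ∧ Bad = Φ.bad ∧ clause` — for `Bad := Φ.bad`.  §3 of record (dressed class weights `classWeightOfDatum₉` of a
Stage-9 tuple at one `(p, g, k, t)`, `T = univ`, displayed provisos on the pieces `χ_k·slot_k`): ★★★ `singleSlotClause_classWeightOfDatum₉_of_fibreDom`, ★★★ `…_of_ratioLetter`, ★★★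
`slotDomBody_classWeightOfDatum₉_of_fibreDom`.  §4 (v1.1, append-only; + import `T4InsertionProfile`): ★★ `pointwiseRatio_of_fibreDom` ∕ `_of_ratioLetter` — the cell's most primitive clause (EN)
`T4InsertionProfile.PointwiseRatio Φ A shape y` («ONE term against ONE term», whose docstring contrasts it with print's «one operation applied to 1») for `A τ = ∫ t_τ` from the fibrewise
letters with the shapes' prices; ★★★ `pointwiseRatio_classWeightOfDatum₉_of_fibreDom` (of record).

HONEST FRAMING.  [bookkeeping].  The letters hDom ∕ hratio are HYPOTHESES (print's KIND; junction NC-NE7b-α UNRULED; an ESTIMATE — the cell's rows E2-rel (a)∕(b), NE7b-rem); the switch-off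
structure on def-T's index (deletion of one pending component's genealogy, admissibility preserved) is DATA ([IV] p. 177; def-R `PpSelOfRecord` docstring: no canonical deletion; faithful object
the (1.100) datum); the budget `Σ x ≤ S K` and its two-rate form are the cell's counting half (`T4PersistentHistoryCount`), NOT here; the keying of all `(K, t)` at the record's carriers (a
`SlotDom` over ONE index type) is the lineage's keyed layer, NOT here.  NO weight is bounded, NO estimate proved; nothing of Bałaban's asserted; NE7 ∕ NE7b ∕ NE7c NOT PRINTED for `d = 4` ∕ NOT
proved; no `Stage9Params.Provisos` inhabitant claimed (K0⁷ OPEN); K3⁸ untouched; N20 NOT discharged; counts UNMOVED (typed 28∕28 · discharged 8∕27); one finite four-torus programme at fixed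
`ε` — NOT ℝ⁴, NOT OS, NOT a mass gap, NOT the Clay problem.  No `def`, no `instance`, no `notation`, no `sorry`; no decl below carries a cite tag.
-/

noncomputable section

open MeasureTheory
open scoped BigOperators
open Finset

namespace YMDAG.UVSplit

open Literature.MathematicalPhysics.QuantumFieldTheory.Balaban1983to89
open Literature.MathematicalPhysics.QuantumFieldTheory.Balaban1983to89.T4Continuum
open Literature.MathematicalPhysics.QuantumFieldTheory.Balaban1983to89.Node00
open Literature.MathematicalPhysics.QuantumFieldTheory.Balaban1983to89.B15.BasicStep (fibreIntegral)
open Literature.MathematicalPhysics.QuantumFieldTheory.Balaban1983to89.T4HistoryPeeling (SwitchOff)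

/-! ## §1 The single-slot clause from per-history fibrewise letters on one switch-off fibre -/

section Generic

variable {P : Params} {G : Type*} [GaugeGroup G] [MeasurableSpace G] [HaarData G] {j : ℕ}
variable {ι : Type*} [DecidableEq ι] {T : Finset ι} {n : ℕ}

/-- ★★ **THE SINGLE-SLOT CLAUSE OF `SlotDom` FROM FIBREWISE LETTERS.**  Densities `t ≥ 0` integrable measurable, a switch-off structure `Φ` on `T`, a slot `i` with fibre sets `fib i τ`
and factors `z i τ` on its pending terms: if every pending `τ ∈ T` is fibrewise dominated by its switch-off — `∫⌈_{fib i τ} t_τ ≤ z i τ · ∫⌈_{fib i τ} t_{off i τ}` at every `V` — and for the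
context `τ″` the fibre count is `Σ_{τ ∈ T : pend i τ ∧ off i τ = τ″} z i τ ≤ x i` with `0 ≤ x i`, then `Σ_{τ ∈ T : pend i τ ∧ off i τ = τ″} ∫ t_τ ≤ x i · ∫ t_{τ″}` (companion §2 on the one
fibre; its image under `off i` is inside `{τ″}`). [bookkeeping] -/
theorem singleSlotClause_of_fibreDom {iP : DecidableEq (PBond P j)} (t : ι → Density P j G) (Φ : SwitchOff T n) (i : Fin n)
    (fib : Fin n → ι → Finset (PBond P j)) (z : Fin n → ι → ℝ) {x : Fin n → ℝ}
    (hm : ∀ s, Measurable (t s)) (h0 : ∀ s V, 0 ≤ t s V) (hint : ∀ s, Integrable (t s) (fieldMeasure P j G))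
    (hDom : ∀ τ ∈ T, Φ.pend i τ = true → ∀ V, fibreIntegral (fib i τ) (t τ) V ≤ z i τ * fibreIntegral (fib i τ) (t (Φ.off i τ)) V)
    (τ'' : ι) (hx0 : 0 ≤ x i) (hx : ∑ τ ∈ T.filter (fun τ => Φ.pend i τ = true ∧ Φ.off i τ = τ''), z i τ ≤ x i) :
    ∑ τ ∈ T.filter (fun τ => Φ.pend i τ = true ∧ Φ.off i τ = τ''), ∫ V, t τ V ∂fieldMeasure P j G ≤ x i * ∫ V, t τ'' V ∂fieldMeasure P j G := by
  set B := T.filter (fun τ => Φ.pend i τ = true ∧ Φ.off i τ = τ'') with hB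
  have hBmem : ∀ τ ∈ B, τ ∈ T ∧ Φ.pend i τ = true ∧ Φ.off i τ = τ'' := fun τ hτ => by
    simpa [hB, Finset.mem_filter] using hτ
  have himg : B.image (Φ.off i) ⊆ {τ''} := by
    intro σ hσ
    obtain ⟨τ, hτ, rfl⟩ := Finset.mem_image.1 hσ
    exact Finset.mem_singleton.2 (hBmem τ hτ).2.2
  have hfib : ∀ σ ∈ B.image (Φ.off i), B.filter (fun s => Φ.off i s = σ) = B := by
    intro σ hσ
    rw [Finset.mem_singleton.1 (himg hσ)]
    exact Finset.filter_true_of_mem fun τ hτ => (hBmem τ hτ).2.2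
  have h1 := sum_integral_le_mul_sum_image_of_fibreDom (W := x i) t (fib i) B (Φ.off i) (z i) hm h0 hint
    (fun τ hτ => hDom τ (hBmem τ hτ).1 (hBmem τ hτ).2.1) (fun σ hσ => (Finset.sum_congr (hfib σ hσ) fun _ _ => rfl).le.trans hx)
  refine h1.trans (mul_le_mul_of_nonneg_left ?_ hx0)
  calc ∑ σ ∈ B.image (Φ.off i), ∫ V, t σ V ∂fieldMeasure P j G
      ≤ ∑ σ ∈ ({τ''} : Finset ι), ∫ V, t σ V ∂fieldMeasure P j G :=
        Finset.sum_le_sum_of_subset_of_nonneg himg fun σ _ _ => integral_nonneg (h0 σ)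
    _ = ∫ V, t τ'' V ∂fieldMeasure P j G := Finset.sum_singleton _ _

/-- **… FROM THE SUP FORM OF THE LETTER** (ratio bound + support clause, companion `fibreDom_of_ratio_le`). [bookkeeping] -/
theorem singleSlotClause_of_ratioLetter {iP : DecidableEq (PBond P j)} (t : ι → Density P j G) (Φ : SwitchOff T n) (i : Fin n)
    (fib : Fin n → ι → Finset (PBond P j)) (z : Fin n → ι → ℝ) {x : Fin n → ℝ}
    (hm : ∀ s, Measurable (t s)) (h0 : ∀ s V, 0 ≤ t s V) (hint : ∀ s, Integrable (t s) (fieldMeasure P j G))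
    (hratio : ∀ τ ∈ T, Φ.pend i τ = true → ∀ V, fibreIntegral (fib i τ) (t τ) V / fibreIntegral (fib i τ) (t (Φ.off i τ)) V ≤ z i τ)
    (hsupp : ∀ τ ∈ T, Φ.pend i τ = true → ∀ V, fibreIntegral (fib i τ) (t (Φ.off i τ)) V = 0 → fibreIntegral (fib i τ) (t τ) V = 0)
    (τ'' : ι) (hx0 : 0 ≤ x i) (hx : ∑ τ ∈ T.filter (fun τ => Φ.pend i τ = true ∧ Φ.off i τ = τ''), z i τ ≤ x i) :
    ∑ τ ∈ T.filter (fun τ => Φ.pend i τ = true ∧ Φ.off i τ = τ''), ∫ V, t τ V ∂fieldMeasure P j G ≤ x i * ∫ V, t τ'' V ∂fieldMeasure P j G :=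
  singleSlotClause_of_fibreDom t Φ i fib z hm h0 hint
    (fun τ hτ hp V => fibreDom_of_ratio_le (fib i τ) (hratio τ hτ hp) (hsupp τ hτ hp) V) τ'' hx0 hx

/-! ## §2 The body of `SlotDom.dom` at one `(K, t)` -/

/-- ★★ **THE BODY OF `T4HistoryPeeling.SlotDom.dom` AT ONE `(K, t)`** for the weights `A τ = ∫ t_τ` and the bad class `Φ.bad`: a switch-off structure `Φ`, non-negative activities `x` with a
budget `Σ_i x i ≤ S`, per-history fibrewise letters on every slot's pending terms and the fibre counts `≤ x i` uniformly in the context ⇒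
`∃ n Φ x, (∀ i, 0 ≤ x i) ∧ Σ x ≤ S ∧ Φ.bad = Φ.bad ∧ (single-slot clause)` — literally the existential the cell's structure asks for, at this `(K, t)`. [bookkeeping] -/
theorem slotDomBody_of_fibreDom {iP : DecidableEq (PBond P j)} (t : ι → Density P j G) (Φ : SwitchOff T n)
    (fib : Fin n → ι → Finset (PBond P j)) (z : Fin n → ι → ℝ) (x : Fin n → ℝ) {S : ℝ}
    (hm : ∀ s, Measurable (t s)) (h0 : ∀ s V, 0 ≤ t s V) (hint : ∀ s, Integrable (t s) (fieldMeasure P j G))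
    (hDom : ∀ i, ∀ τ ∈ T, Φ.pend i τ = true → ∀ V, fibreIntegral (fib i τ) (t τ) V ≤ z i τ * fibreIntegral (fib i τ) (t (Φ.off i τ)) V)
    (hx0 : ∀ i, 0 ≤ x i) (hx : ∀ i τ'', ∑ τ ∈ T.filter (fun τ => Φ.pend i τ = true ∧ Φ.off i τ = τ''), z i τ ≤ x i) (hS : ∑ i, x i ≤ S) :
    ∃ (n : ℕ) (Φ' : SwitchOff T n) (x : Fin n → ℝ), (∀ i, 0 ≤ x i) ∧ ∑ i, x i ≤ S ∧ Φ.bad = Φ'.bad ∧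
      ∀ i : Fin n, ∀ τ'' ∈ T, Φ'.pend i τ'' = false →
        ∑ τ ∈ T.filter (fun τ => Φ'.pend i τ = true ∧ Φ'.off i τ = τ''), ∫ V, t τ V ∂fieldMeasure P j G ≤ x i * ∫ V, t τ'' V ∂fieldMeasure P j G :=
  ⟨n, Φ, x, hx0, hS, rfl, fun i τ'' _ _ => singleSlotClause_of_fibreDom t Φ i fib z hm h0 hint (hDom i) τ'' (hx0 i) (hx i τ'')⟩

end Generic

/-! ## §3 Of record: the dressed class weights of a Stage-9 tuple at one `(p, g, k, t)` -/

section Record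

variable {F : T4Family} {N : ℕ} [NeZero N]
variable (ϑ : Stage9Params F N) (D : FiniteEpsData F (SU N)) (g₀ : ℕ → ℝ) (os : List (ULoop F)) (p : B12.RunParams) (g : ℕ → ℝ) (k : ℕ) (t : ℝ)

open scoped Classical in
/-- ★★★ **THE SINGLE-SLOT CLAUSE FOR N20's CLASS WEIGHTS AT ONE `(p, g, k, t)`**: a switch-off structure `Φ` on ALL level-`k` sequences of record (`T = univ`), a slot `i` with fibre sets and
factors; under the displayed provisos on the pieces `χ_k(s)·slot_k(s)` (measurable, `≥ 0`, integrable), the per-history letter hDom «`∫⌈_{fib i s}(χ_k(s)slot_k(s)) ≤ z i s · ∫⌈_{fib i s}(χ_k(off i s)slot_k(off i s))`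
at every `V`, for `s` pending at `i`» and the fibre count `≤ x i` (`0 ≤ x i`) give `Σ_{s : pend i s ∧ off i s = σ} cw_k(s) ≤ x i · cw_k(σ)`. [bookkeeping] -/
theorem singleSlotClause_classWeightOfDatum₉_of_fibreDom {n : ℕ} (Φ : SwitchOff (Finset.univ : Finset (SeqOfRecord F ϑ.ν ϑ.τ9.M g p.K k)) n) (i : Fin n)
    (fib : Fin n → SeqOfRecord F ϑ.ν ϑ.τ9.M g p.K k → Finset (PBond (F.P p.K) k)) (z : Fin n → SeqOfRecord F ϑ.ν ϑ.τ9.M g p.K k → ℝ) {x : Fin n → ℝ}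
    (hm : ∀ s, Measurable fun V => chiSeqOfRecord F N ϑ.ν ϑ.τ9.M g p.K k s V * dressedSlotsOfDatum₉ F N ϑ D g₀ os t p g k s V)
    (h0 : ∀ s V, 0 ≤ chiSeqOfRecord F N ϑ.ν ϑ.τ9.M g p.K k s V * dressedSlotsOfDatum₉ F N ϑ D g₀ os t p g k s V)
    (hint : ∀ s, Integrable (fun V => chiSeqOfRecord F N ϑ.ν ϑ.τ9.M g p.K k s V * dressedSlotsOfDatum₉ F N ϑ D g₀ os t p g k s V)
      (fieldMeasure (F.P p.K) k (SU N)))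
    (hDom : ∀ s, Φ.pend i s = true → ∀ V,
      fibreIntegral (fib i s) (fun V => chiSeqOfRecord F N ϑ.ν ϑ.τ9.M g p.K k s V * dressedSlotsOfDatum₉ F N ϑ D g₀ os t p g k s V) V ≤
        z i s * fibreIntegral (fib i s)
          (fun V => chiSeqOfRecord F N ϑ.ν ϑ.τ9.M g p.K k (Φ.off i s) V * dressedSlotsOfDatum₉ F N ϑ D g₀ os t p g k (Φ.off i s) V) V)
    (σ : SeqOfRecord F ϑ.ν ϑ.τ9.M g p.K k) (hx0 : 0 ≤ x i)
    (hx : ∑ s ∈ Finset.univ.filter (fun s => Φ.pend i s = true ∧ Φ.off i s = σ), z i s ≤ x i) :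
    ∑ s ∈ Finset.univ.filter (fun s => Φ.pend i s = true ∧ Φ.off i s = σ), classWeightOfDatum₉ F N ϑ D g₀ os p g k t s ≤
      x i * classWeightOfDatum₉ F N ϑ D g₀ os p g k t σ := by
  unfold classWeightOfDatum₉
  exact singleSlotClause_of_fibreDom
    (fun s V => chiSeqOfRecord F N ϑ.ν ϑ.τ9.M g p.K k s V * dressedSlotsOfDatum₉ F N ϑ D g₀ os t p g k s V) Φ i fib z hm h0 hint
    (fun s _ hp => hDom s hp) σ hx0 hx

open scoped Classical in
/-- ★★★ **… FROM THE SUP FORM OF THE LETTER** (ratio bound + support clause). [bookkeeping] -/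
theorem singleSlotClause_classWeightOfDatum₉_of_ratioLetter {n : ℕ} (Φ : SwitchOff (Finset.univ : Finset (SeqOfRecord F ϑ.ν ϑ.τ9.M g p.K k)) n) (i : Fin n)
    (fib : Fin n → SeqOfRecord F ϑ.ν ϑ.τ9.M g p.K k → Finset (PBond (F.P p.K) k)) (z : Fin n → SeqOfRecord F ϑ.ν ϑ.τ9.M g p.K k → ℝ) {x : Fin n → ℝ}
    (hm : ∀ s, Measurable fun V => chiSeqOfRecord F N ϑ.ν ϑ.τ9.M g p.K k s V * dressedSlotsOfDatum₉ F N ϑ D g₀ os t p g k s V)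
    (h0 : ∀ s V, 0 ≤ chiSeqOfRecord F N ϑ.ν ϑ.τ9.M g p.K k s V * dressedSlotsOfDatum₉ F N ϑ D g₀ os t p g k s V)
    (hint : ∀ s, Integrable (fun V => chiSeqOfRecord F N ϑ.ν ϑ.τ9.M g p.K k s V * dressedSlotsOfDatum₉ F N ϑ D g₀ os t p g k s V)
      (fieldMeasure (F.P p.K) k (SU N)))
    (hratio : ∀ s, Φ.pend i s = true → ∀ V,
      fibreIntegral (fib i s) (fun V => chiSeqOfRecord F N ϑ.ν ϑ.τ9.M g p.K k s V * dressedSlotsOfDatum₉ F N ϑ D g₀ os t p g k s V) V /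
        fibreIntegral (fib i s)
          (fun V => chiSeqOfRecord F N ϑ.ν ϑ.τ9.M g p.K k (Φ.off i s) V * dressedSlotsOfDatum₉ F N ϑ D g₀ os t p g k (Φ.off i s) V) V ≤ z i s)
    (hsupp : ∀ s, Φ.pend i s = true → ∀ V,
      fibreIntegral (fib i s)
          (fun V => chiSeqOfRecord F N ϑ.ν ϑ.τ9.M g p.K k (Φ.off i s) V * dressedSlotsOfDatum₉ F N ϑ D g₀ os t p g k (Φ.off i s) V) V = 0 →
        fibreIntegral (fib i s) (fun V => chiSeqOfRecord F N ϑ.ν ϑ.τ9.M g p.K k s V * dressedSlotsOfDatum₉ F N ϑ D g₀ os t p g k s V) V = 0)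
    (σ : SeqOfRecord F ϑ.ν ϑ.τ9.M g p.K k) (hx0 : 0 ≤ x i)
    (hx : ∑ s ∈ Finset.univ.filter (fun s => Φ.pend i s = true ∧ Φ.off i s = σ), z i s ≤ x i) :
    ∑ s ∈ Finset.univ.filter (fun s => Φ.pend i s = true ∧ Φ.off i s = σ), classWeightOfDatum₉ F N ϑ D g₀ os p g k t s ≤
      x i * classWeightOfDatum₉ F N ϑ D g₀ os p g k t σ :=
  singleSlotClause_classWeightOfDatum₉_of_fibreDom ϑ D g₀ os p g k t Φ i fib z hm h0 hint
    (fun s hp V => fibreDom_of_ratio_le (fib i s) (hratio s hp) (hsupp s hp) V) σ hx0 hx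

open scoped Classical in
/-- ★★★ **THE BODY OF `SlotDom.dom` FOR N20's CLASS WEIGHTS AT ONE `(p, g, k, t)`**: switch-off structure on the level-`k` sequences of record, activities `0 ≤ x` with budget `Σ x ≤ S`,
per-history fibrewise letters on every slot and fibre counts `≤ x i` ⇒ the existential of `T4HistoryPeeling.SlotDom.dom` at this `(K, t)` with `A = cw_k`, `T = univ`, `Bad = Φ.bad` — what
both runs must supply, per `(K, t)` and keyed at the record's carriers, for the cell's `relWeightBound_of_slotDom_twoRate` to give NE7b's `RelWeightBound` BY NAME. [bookkeeping] -/
theorem slotDomBody_classWeightOfDatum₉_of_fibreDom {n : ℕ} (Φ : SwitchOff (Finset.univ : Finset (SeqOfRecord F ϑ.ν ϑ.τ9.M g p.K k)) n)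
    (fib : Fin n → SeqOfRecord F ϑ.ν ϑ.τ9.M g p.K k → Finset (PBond (F.P p.K) k)) (z : Fin n → SeqOfRecord F ϑ.ν ϑ.τ9.M g p.K k → ℝ) (x : Fin n → ℝ) {S : ℝ}
    (hm : ∀ s, Measurable fun V => chiSeqOfRecord F N ϑ.ν ϑ.τ9.M g p.K k s V * dressedSlotsOfDatum₉ F N ϑ D g₀ os t p g k s V)
    (h0 : ∀ s V, 0 ≤ chiSeqOfRecord F N ϑ.ν ϑ.τ9.M g p.K k s V * dressedSlotsOfDatum₉ F N ϑ D g₀ os t p g k s V)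
    (hint : ∀ s, Integrable (fun V => chiSeqOfRecord F N ϑ.ν ϑ.τ9.M g p.K k s V * dressedSlotsOfDatum₉ F N ϑ D g₀ os t p g k s V)
      (fieldMeasure (F.P p.K) k (SU N)))
    (hDom : ∀ i s, Φ.pend i s = true → ∀ V,
      fibreIntegral (fib i s) (fun V => chiSeqOfRecord F N ϑ.ν ϑ.τ9.M g p.K k s V * dressedSlotsOfDatum₉ F N ϑ D g₀ os t p g k s V) V ≤
        z i s * fibreIntegral (fib i s)
          (fun V => chiSeqOfRecord F N ϑ.ν ϑ.τ9.M g p.K k (Φ.off i s) V * dressedSlotsOfDatum₉ F N ϑ D g₀ os t p g k (Φ.off i s) V) V)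
    (hx0 : ∀ i, 0 ≤ x i) (hx : ∀ i σ, ∑ s ∈ Finset.univ.filter (fun s => Φ.pend i s = true ∧ Φ.off i s = σ), z i s ≤ x i) (hS : ∑ i, x i ≤ S) :
    ∃ (n : ℕ) (Φ' : SwitchOff (Finset.univ : Finset (SeqOfRecord F ϑ.ν ϑ.τ9.M g p.K k)) n) (x : Fin n → ℝ), (∀ i, 0 ≤ x i) ∧ ∑ i, x i ≤ S ∧ Φ.bad = Φ'.bad ∧
      ∀ i : Fin n, ∀ σ ∈ (Finset.univ : Finset (SeqOfRecord F ϑ.ν ϑ.τ9.M g p.K k)), Φ'.pend i σ = false →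
        ∑ s ∈ Finset.univ.filter (fun s => Φ'.pend i s = true ∧ Φ'.off i s = σ), classWeightOfDatum₉ F N ϑ D g₀ os p g k t s ≤
          x i * classWeightOfDatum₉ F N ϑ D g₀ os p g k t σ :=
  ⟨n, Φ, x, hx0, hS, rfl, fun i σ _ _ =>
    singleSlotClause_classWeightOfDatum₉_of_fibreDom ϑ D g₀ os p g k t Φ i fib z hm h0 hint (hDom i) σ (hx0 i) (hx i σ)⟩

end Record

/-! ## §4 (v1.1) One level more primitive: the cell's pointwise insertion ratio (EN) `T4InsertionProfile.PointwiseRatio`, term against term, from the fibrewise letter -/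

section Pointwise

variable {P : Params} {G : Type*} [GaugeGroup G] [MeasurableSpace G] [HaarData G] {j : ℕ}
variable {ι : Type*} {T : Finset ι} {n : ℕ} {σ : Type*}

/-- ★★ **(EN) FROM THE FIBREWISE LETTER, BY NAME.**  The pub-balaban cell's most primitive NE7b clause `T4InsertionProfile.PointwiseRatio Φ A shape y` — «for every pending term
`τ` of slot `i`: `A τ ≤ y i (shape i τ) · A (off i τ)`, ONE term against ONE term, the price depending on the slot and the SHAPE only» (its docstring: «the printed sup-bounds (1.79)
p. 383 ∕ (1.89) p. 387 on `T′_k(X)1` are bounds for ONE operation applied to `1`, not this ratio») — HOLDS for the weights `A τ = ∫ t_τ` as soon as every pending term is FIBREWISE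
dominated by its switch-off with the shape's price: `∫⌈_{fib i τ} t_τ ≤ y i (shape i τ) · ∫⌈_{fib i τ} t_{off i τ}` at every `V` (companion `integral_le_mul_integral_of_fibreDom`:
Fubini ×2).  So on def-R's objects a sup bound on [IV] (0.3)'s fibre ratio IS a term-against-term ratio; what remains between print and (EN) is the identification of that fibre
ratio with print's `𝐓′_k(X)1` (junction NC-NE7b-α), not the passage from «one operation applied to 1» to «a ratio of two terms». [bookkeeping] -/
theorem pointwiseRatio_of_fibreDom {iP : DecidableEq (PBond P j)} (t : ι → Density P j G) (Φ : SwitchOff T n)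
    (fib : Fin n → ι → Finset (PBond P j)) (shape : Fin n → ι → σ) (y : Fin n → σ → ℝ)
    (hm : ∀ s, Measurable (t s)) (h0 : ∀ s V, 0 ≤ t s V) (hint : ∀ s, Integrable (t s) (fieldMeasure P j G))
    (hDom : ∀ i, ∀ τ ∈ T, Φ.pend i τ = true → ∀ V,
      fibreIntegral (fib i τ) (t τ) V ≤ y i (shape i τ) * fibreIntegral (fib i τ) (t (Φ.off i τ)) V) :
    T4InsertionProfile.PointwiseRatio Φ (fun τ => ∫ V, t τ V ∂fieldMeasure P j G) shape y :=
  fun i τ hτ hp => integral_le_mul_integral_of_fibreDom (fib i τ) (hm τ) (hm (Φ.off i τ)) (h0 τ) (h0 (Φ.off i τ)) (hint τ) (hint (Φ.off i τ)) (hDom i τ hτ hp)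

/-- **… FROM THE SUP FORM** (ratio bound with the shape's price + support clause). [bookkeeping] -/
theorem pointwiseRatio_of_ratioLetter {iP : DecidableEq (PBond P j)} (t : ι → Density P j G) (Φ : SwitchOff T n)
    (fib : Fin n → ι → Finset (PBond P j)) (shape : Fin n → ι → σ) (y : Fin n → σ → ℝ)
    (hm : ∀ s, Measurable (t s)) (h0 : ∀ s V, 0 ≤ t s V) (hint : ∀ s, Integrable (t s) (fieldMeasure P j G))
    (hratio : ∀ i, ∀ τ ∈ T, Φ.pend i τ = true → ∀ V, fibreIntegral (fib i τ) (t τ) V / fibreIntegral (fib i τ) (t (Φ.off i τ)) V ≤ y i (shape i τ))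
    (hsupp : ∀ i, ∀ τ ∈ T, Φ.pend i τ = true → ∀ V, fibreIntegral (fib i τ) (t (Φ.off i τ)) V = 0 → fibreIntegral (fib i τ) (t τ) V = 0) :
    T4InsertionProfile.PointwiseRatio Φ (fun τ => ∫ V, t τ V ∂fieldMeasure P j G) shape y :=
  pointwiseRatio_of_fibreDom t Φ fib shape y hm h0 hint fun i τ hτ hp V => fibreDom_of_ratio_le (fib i τ) (hratio i τ hτ hp) (hsupp i τ hτ hp) V

/-- ★★★ **(EN) FOR N20's CLASS WEIGHTS AT ONE `(p, g, k, t)`**: for a switch-off structure on the level-`k` sequences of record, a shape profile and prices, the fibrewise letters with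
the shapes' prices (displayed provisos on the pieces `χ_k·slot_k`) give `PointwiseRatio Φ (cw_k) shape y` — the (EN) clause of the cell's `T4InsertionProfile.PointDom` for this run at
this `(K, t)`; (INS) and (ENT) are combinatorics of the removal structure and the budget, NOT here. [bookkeeping] -/
theorem pointwiseRatio_classWeightOfDatum₉_of_fibreDom {F : T4Family} {N : ℕ} [NeZero N] (ϑ : Stage9Params F N) (D : FiniteEpsData F (SU N)) (g₀ : ℕ → ℝ)
    (os : List (ULoop F)) (p : B12.RunParams) (g : ℕ → ℝ) (k : ℕ) (t : ℝ) {T : Finset (SeqOfRecord F ϑ.ν ϑ.τ9.M g p.K k)} (Φ : SwitchOff T n)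
    (fib : Fin n → SeqOfRecord F ϑ.ν ϑ.τ9.M g p.K k → Finset (PBond (F.P p.K) k)) (shape : Fin n → SeqOfRecord F ϑ.ν ϑ.τ9.M g p.K k → σ) (y : Fin n → σ → ℝ)
    (hm : ∀ s, Measurable fun V => chiSeqOfRecord F N ϑ.ν ϑ.τ9.M g p.K k s V * dressedSlotsOfDatum₉ F N ϑ D g₀ os t p g k s V)
    (h0 : ∀ s V, 0 ≤ chiSeqOfRecord F N ϑ.ν ϑ.τ9.M g p.K k s V * dressedSlotsOfDatum₉ F N ϑ D g₀ os t p g k s V)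
    (hint : ∀ s, Integrable (fun V => chiSeqOfRecord F N ϑ.ν ϑ.τ9.M g p.K k s V * dressedSlotsOfDatum₉ F N ϑ D g₀ os t p g k s V)
      (fieldMeasure (F.P p.K) k (SU N)))
    (hDom : ∀ i, ∀ s ∈ T, Φ.pend i s = true → ∀ V,
      fibreIntegral (fib i s) (fun V => chiSeqOfRecord F N ϑ.ν ϑ.τ9.M g p.K k s V * dressedSlotsOfDatum₉ F N ϑ D g₀ os t p g k s V) V ≤
        y i (shape i s) * fibreIntegral (fib i s)
          (fun V => chiSeqOfRecord F N ϑ.ν ϑ.τ9.M g p.K k (Φ.off i s) V * dressedSlotsOfDatum₉ F N ϑ D g₀ os t p g k (Φ.off i s) V) V) :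
    T4InsertionProfile.PointwiseRatio Φ (fun s => classWeightOfDatum₉ F N ϑ D g₀ os p g k t s) shape y := by
  unfold classWeightOfDatum₉
  exact pointwiseRatio_of_fibreDom
    (fun s V => chiSeqOfRecord F N ϑ.ν ϑ.τ9.M g p.K k s V * dressedSlotsOfDatum₉ F N ϑ D g₀ os t p g k s V) Φ fib shape y hm h0 hint hDom

end Pointwise

end YMDAG.UVSplit
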